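import Mathlib
import Literature.NumberTheory.LFunctions.Zhang2022.Section8Eq81bEdge
import Literature.NumberTheory.LFunctions.Zhang2022.Section8Eq81aResidue
import Literature.NumberTheory.LFunctions.Zhang2022.Section8AdmissibleRectangle
import Literature.NumberTheory.LFunctions.Zhang2022.Section4Lemma44Chain
import HarnessLib

/-!
# Zhang (2022) §8 (8.1), abstract form: the residue + contour-remainder ENGINE for integrands
# `(L(s+β₁,ψ)/L(s,ψ))·G(s)·ω(s)` — kernel-checked, reusable by §13, §15, §16, §17

Topic `Literature/NumberTheory/LFunctions/Zhang2022` (Landau–Siegel audit tree; verdict-neutral).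
Y. Zhang, *Discrete mean estimates and the Landau–Siegel zero*, arXiv:2211.02515v1 (2022)
[Zhang2022LandauSiegel] — **an unrefereed manuscript under adjudication**; nothing here asserts or
denies its Theorems 1–2. The manuscript invokes ONE contour argument four times, each time by the words
"similar to (8.1)": §8 (8.1) p. 42 (tex L2197–L2206: "By Proposition 2.2, we can choose a rectangle `ℜ`
with vertices at `s₀ ± α + i𝓛₁^{±}` … the set of zeros of `L(s,ψ)` inside `ℜ` is exactly `𝔷(ψ)` …
By Lemma 5.9, the residue theorem and a simple bound for `ω(s)`,
`Σ_ρ … ω(ρ) = (1/2πi)∫_ℜ … = Ĩ⁺ − Ĩ⁻ + O(ε)`"), §13 p. 75 (tex L3810–L3817, the example behind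
(13.11)), §15 p. 80 (tex L3999, `Z22:§15.u002`: "Similar to (8.1), for `ψ ∈ Ψ₁` we have
`Σ_{ρ∈𝔷(ψ)} 𝔨₁*(ρ,ψ)ω(ρ) = I₂⁺(ψ) − I₂⁻(ψ) + O(ε)`"), §16 p. 88 (tex L4408, `Z22:§16.u002`) and §17
p. 95 (tex L4706, (17.1)). In every instance the integrand has the shape
`F(s) = (L(s+β₁,ψ)/L(s,ψ))·G(s)·ω(s)` with `G` holomorphic on the upper half-plane and of size
`e^{O(𝓛⁹)}` near the contour (`G = −i[Y₁Y₂Y₃/Y]M(s+β₂)M(s+β₃)/Y…` for (8.1); `Z(s,χψ)⁻¹L(s+β₂)BK`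
for `𝔨₁`; `Z(s,χψ)⁻¹BNK` for `𝔨₂`; `BGNNF̄` for `𝔨₃`), and the residue at a (simple, Prop. 2.2 (ii))
zero `ρ` is `(L(ρ+β₁,ψ)/L′(ρ,ψ))·G(ρ)·ω(ρ)`.

This file proves that argument ONCE, for an ARBITRARY such `G` (theorems only; no definitions, no
named facts), by abstracting the tree's kernel proofs of (8.1)
(`Section8Eq81aResidue.eq81a_at`, `Section8Eq81bEdge.eq81b_of_prop22`, sz L2 DISCHARGE #5,
from which parts E–H below are adapted with attribution):

* `sum_div_deriv_LFunction_eq_rectIntegral` — the residue theorem on an admissible rectangle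
  (`Section8aStatements.AdmRect`, the typed object of `Z22:§8.u003`) for `F = N/L(·,ψ)` with ANY
  numerator `N` holomorphic on `{Im s > 0}`: `Σ_{ρ∈𝔷(ψ)} N(ρ)/L′(ρ,ψ) = (1/2πi)∮_{∂ℜ} N/L`
  (poles = `𝔷(ψ)` by admissibility, simple by Prop. 2.2 (ii); the tree's residue theorem
  `Literature.Analysis.Complex.rectBoundaryIntegral_eq_sum_of_simplePoles`, Conway V.2.2);
* `norm_rectIntegral_sub_segInt_le_of_bound` — "a simple bound for `ω(s)`": for
  `F = (L(s+β₁)/L(s))·G·ω`, `‖(1/2πi)∮_{∂ℜ}F − ((1/2πi)∫_{𝔍(α)}F − (1/2πi)∫_{𝔍(−α)}F)‖ ≤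
  C₅₉·log P·G_b·e^{2−𝓛¹⁰/4}` whenever `‖G‖ ≤ G_b` on the boundary zone `|σ − ½| ≤ α`,
  `𝓛₁ − 1 ≤ |t − 2πt₀| ≤ 𝓛₁ + ¼` (Lemma 5.9 on its use-range for the ratio, the clearance on
  `σ = ½ ± α` from Prop. 2.2 (i), `|ω| ≤ e^{2−𝓛¹⁰/4}` there; the six-piece contour bookkeeping of
  `Section8Eq81bEdge.rectIntegral_sub_segInt_eq`);
* `lratio_residue_edge_of_prop22` — the packaged engine: for `c′ ≥ 0` with `Skeleton.Prop22 c′` and any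
  growth exponent `κ`, there is `C′` such that for all large `D`, every `ψ ∈ Ψ₁` and EVERY `G`
  holomorphic on `{Im s > 0}` with `‖G(s)‖ ≤ e^{κ𝓛⁹}` on the boundary zone,
  `‖Σ_{ρ∈𝔷(ψ)} (L(ρ+β₁,ψ)/L′(ρ,ψ))G(ρ)ω(ρ) − ((1/2πi)∫_{𝔍(α)}F − (1/2πi)∫_{𝔍(−α)}F)‖ ≤ C′e^{−𝓛¹⁰/8}`
  (the threshold depends on `c′`, `κ` and the admissibility constants only — not on `G`).

Consumers (ZHANG-L discharge lane): `Typed.Section15A.Step15_u002` (𝔨₁), `Typed.Section16A.Step16_u002`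
(𝔨₂), `Typed.Section17.Eq17_1` (𝔨₃), `Typed.Section13.U007`. WHAT THIS IS NOT: a claim about
Proposition 2.2 (an input), about (8.1)/(15.3)/(16.u002)/(17.1) beyond this contour step, about
Theorems 1–2 of the source, or about Landau–Siegel zeros.

## References

* Y. Zhang, arXiv:2211.02515v1 (2022), §8 (8.1) p. 42 (tex L2197–L2210); §5 Lemma 5.9 p. 29; §2
  (2.13)–(2.15). [cite: Zhang2022LandauSiegel, §8 (8.1) p. 42]
* J. B. Conway, *Functions of One Complex Variable I*, 2nd ed. (1978), Ch. V Thm. 2.2 (residue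
  theorem; the tree's `RectangleResidueSimplePoles`). [cite: Conway1978, Ch. V Thm. 2.2]
-/

noncomputable section

open Complex Real Set Filter Topology MeasureTheory intervalIntegral

namespace Literature.NumberTheory.LFunctions.Zhang2022.Section8aStatements

open Skeleton
open Literature.Analysis.Complex (rectBoundaryIntegral rectBoundaryIntegral_eq_sum_of_simplePoles)

/-! ### A. The residue theorem for `N/L(·,ψ)` on an admissible rectangle -/

/-- Clamping `v` into `[lo, hi]` (coordinatewise projection onto the closed rectangle); copy of the
private helper of `Section8Eq81aResidue`. [folklore] -/
private theorem clamp_spec' {lo hi v δ : ℝ} (hlh : lo ≤ hi) (hδ : 0 < δ) (h1 : lo - δ < v)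
    (h2 : v < hi + δ) :
    lo ≤ max lo (min hi v) ∧ max lo (min hi v) ≤ hi ∧ |max lo (min hi v) - v| < δ ∧
      (v ≤ lo → max lo (min hi v) = lo) ∧ (hi ≤ v → max lo (min hi v) = hi) := by
  refine ⟨le_max_left _ _, max_le hlh (min_le_left _ _), ?_, ?_, ?_⟩
  · rcases le_total hi v with h | h
    · rw [min_eq_left h, max_eq_right hlh, abs_lt]
      constructor <;> linarith
    · rw [min_eq_right h]
      rcases le_total lo v with h' | h'
      · rw [max_eq_right h', sub_self, abs_zero]; exact hδ
      · rw [max_eq_left h', abs_lt]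
        constructor <;> linarith
  · intro hv
    rw [min_eq_right (le_trans hv hlh), max_eq_left hv]
  · intro hv
    rw [min_eq_left hv, max_eq_right hlh]

section Residue

variable {D : ℕ} [NeZero D] (χ : DirichletCharacter ℂ D)

/-- **The residue theorem of (8.1) for an arbitrary numerator.** For `D ≥ 3`, `χ` primitive, `α > 0`,
`c₀ > 0`, heights with `2πt₀ + 𝓛₁⁻ > c₀α` and `𝓛₁⁻ < 𝓛₁⁺`, a character `ψ` whose `Ω`-zeros of
`L(s,ψ)L(s,ψχ)` are simple (Prop. 2.2 (ii)), an admissible rectangle `ℜ`, and ANY `N` holomorphic on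
`{Im s > 0}`: `Σ_{ρ∈𝔷(ψ)} N(ρ)/L′(ρ,ψ) = (1/2πi)∮_{∂ℜ} N(s)/L(s,ψ) ds` — "the set of zeros of `L(s,ψ)`
inside `ℜ` is exactly `𝔷(ψ)` … by the residue theorem" (adapted from `eq81a_at`, numerator `N` in
place of `−iM₁M₂M₃AĀω`, denominator `L(s,ψ)` in place of `M(s,ψ)`).
[cite: Zhang2022LandauSiegel, §8 (8.1) p. 42, tex L2197–L2203] -/
theorem sum_div_deriv_LFunction_eq_rectIntegral (hD : 3 ≤ D) (hχ : χ.IsPrimitive) (x : Chr D)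
    (N : ℂ → ℂ) (hN : DifferentiableOn ℂ N {s : ℂ | 0 < s.im})
    {C c₀ Lm Lp : ℝ} (hc₀ : 0 < c₀) (hα : 0 < alpha D)
    (hLmpos : c₀ * alpha D < 2 * π * t0 D + Lm) (hLmLp : Lm < Lp)
    (h_ii : ∀ s ∈ prodZeroSetOmega χ x,
      deriv (fun w => x.ψ.LFunction w * (psiChi χ x).LFunction w) s ≠ 0)
    (hR : AdmRect D x C c₀ Lm Lp) :
    ∑ ρ ∈ finsetOf (zeroSet D x), N ρ / deriv x.ψ.LFunction ρ =
      rectIntegral D Lm Lp (fun s => N s / x.ψ.LFunction s) := by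
  obtain ⟨-, -, hzeros, hdist⟩ := hR
  set T : ℝ := 2 * π * t0 D with hT
  set δ : ℝ := c₀ * alpha D / 2 with hδ
  have hδ0 : 0 < δ := by positivity
  set F : ℂ → ℂ := fun s => N s / x.ψ.LFunction s with hF_def
  have hLdiff : Differentiable ℂ x.ψ.LFunction :=
    DirichletCharacter.differentiable_LFunction x.ψ_ne_one
  -- the finite set of poles
  have hfin : (zeroSet D x).Finite := zerosFinite_holds D x
  set S : Finset ℂ := finsetOf (zeroSet D x) with hS_def
  have hmemS : ∀ z, z ∈ S ↔ z ∈ zeroSet D x := fun z => mem_finsetOf hfin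
  have hzeroR : ∀ {z}, z ∈ zeroSet D x → z ∈ rectR D Lm Lp := fun {z} hz => by
    have h : z ∈ {ρ | x.ψ.LFunction ρ = 0 ∧ ρ ∈ rectR D Lm Lp} := by rw [hzeros]; exact hz
    exact h.2
  -- the open collar `U` around the closed rectangle
  set U : Set ℂ := Ioo (1 / 2 - alpha D - δ) (1 / 2 + alpha D + δ) ×ℂ Ioo (T + Lm - δ) (T + Lp + δ)
    with hU_def
  have hUo : IsOpen U := isOpen_Ioo.reProdIm isOpen_Ioo
  have hKU : Icc (1 / 2 - alpha D) (1 / 2 + alpha D) ×ℂ Icc (T + Lm) (T + Lp) ⊆ U := by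
    intro z hz
    rw [mem_reProdIm] at hz ⊢
    exact ⟨⟨by linarith [hz.1.1], by linarith [hz.1.2]⟩, ⟨by linarith [hz.2.1], by linarith [hz.2.2]⟩⟩
  have hUim : ∀ z ∈ U, 0 < z.im := fun z hz => by
    rw [mem_reProdIm] at hz; linarith [hz.2.1]
  have hUH : U ⊆ {s : ℂ | 0 < s.im} := fun z hz => hUim z hz
  have hNdiff : DifferentiableOn ℂ N U := hN.mono hUH
  -- a zero of `L(s,ψ)` in the collar lies in `𝔷(ψ)` (else it is within `c₀α` of `∂ℜ`)
  have hLzero : ∀ z ∈ U, x.ψ.LFunction z = 0 → z ∈ zeroSet D x := by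
    intro z hz hL
    by_cases hrect : z ∈ rectR D Lm Lp
    · have h : z ∈ {ρ | x.ψ.LFunction ρ = 0 ∧ ρ ∈ rectR D Lm Lp} := ⟨hL, hrect⟩
      rwa [hzeros] at h
    · exfalso
      rw [mem_reProdIm] at hz
      obtain ⟨⟨hzr1, hzr2⟩, ⟨hzi1, hzi2⟩⟩ := hz
      obtain ⟨hr1, hr2, hr3, hr4, hr5⟩ :=
        clamp_spec' (lo := 1 / 2 - alpha D) (hi := 1 / 2 + alpha D) (v := z.re) (by linarith) hδ0
          hzr1 hzr2
      obtain ⟨hi1, hi2, hi3, hi4, hi5⟩ :=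
        clamp_spec' (lo := T + Lm) (hi := T + Lp) (v := z.im) (by linarith) hδ0 hzi1 hzi2
      set s : ℂ := ⟨max (1 / 2 - alpha D) (min (1 / 2 + alpha D) z.re),
        max (T + Lm) (min (T + Lp) z.im)⟩ with hs_def
      have hsre : s.re = max (1 / 2 - alpha D) (min (1 / 2 + alpha D) z.re) := rfl
      have hsim : s.im = max (T + Lm) (min (T + Lp) z.im) := rfl
      have hsB : s ∈ onBoundaryR D Lm Lp := by
        refine ⟨⟨?_, ?_, ?_⟩, fun hsR => hrect ?_⟩
        · rw [hsre, abs_le]; constructor <;> linarith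
        · rw [hsim]; exact hi1
        · rw [hsim]; exact hi2
        · obtain ⟨h1, h2, h3⟩ := hsR
          rw [hsre] at h1
          rw [hsim] at h2 h3
          refine ⟨?_, ?_, ?_⟩
          · by_contra hc
            rw [not_lt] at hc
            rcases le_abs'.mp hc with h | h
            · rw [hr4 (by linarith)] at h1
              rw [abs_lt] at h1
              linarith [h1.1]
            · rw [hr5 (by linarith)] at h1
              rw [abs_lt] at h1
              linarith [h1.2]
          · by_contra hc
            rw [not_lt] at hc
            rw [hi4 hc] at h2
            exact lt_irrefl _ h2
          · by_contra hc
            rw [not_lt] at hc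
            rw [hi5 hc] at h3
            exact lt_irrefl _ h3
      have hfar := hdist s hsB z hL
      have hnear : ‖s - z‖ < c₀ * alpha D := by
        have h := Complex.norm_le_abs_re_add_abs_im (s - z)
        rw [Complex.sub_re, Complex.sub_im, hsre, hsim] at h
        have : c₀ * alpha D = δ + δ := by rw [hδ]; ring
        linarith
      linarith
  -- `L ≠ 0` on `U ∖ S`, and the integrand is holomorphic there
  have hLne : ∀ z ∈ U, z ∉ zeroSet D x → x.ψ.LFunction z ≠ 0 := fun z hz hzS hL =>
    hzS (hLzero z hz hL)
  have hFdiff : DifferentiableOn ℂ F (U \ ↑S) := by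
    intro z hz
    obtain ⟨hzU, hzS⟩ := hz
    have hzS' : z ∉ zeroSet D x := fun h => hzS (Finset.mem_coe.mpr ((hmemS z).mpr h))
    have hNd : DifferentiableAt ℂ N z := hNdiff.differentiableAt (hUo.mem_nhds hzU)
    exact (hNd.div (hLdiff z) (hLne z hzU hzS')).differentiableWithinAt
  -- the poles are simple, with residues `N(ρ)/L′(ρ,ψ)`
  have hpoles : ∀ p ∈ S, ∃ φ : ℂ → ℂ, ∃ V ∈ 𝓝 p, DifferentiableOn ℂ φ V ∧
      φ p = (fun q => N q / deriv x.ψ.LFunction q) p ∧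
      ∀ z ∈ V, z ≠ p → F z = φ z / (z - p) := by
    intro p hpS
    have hp : p ∈ zeroSet D x := (hmemS p).mp hpS
    have hpR : p ∈ rectR D Lm Lp := hzeroR hp
    have hpU : p ∈ U := by
      obtain ⟨h1, h2, h3⟩ := hpR
      rw [mem_reProdIm]
      have h1' := abs_lt.mp h1
      exact ⟨⟨by linarith [h1'.1], by linarith [h1'.2]⟩, ⟨by linarith, by linarith⟩⟩
    have hL0 : x.ψ.LFunction p = 0 := hp.2.2
    have hpS' : p ∈ prodZeroSetOmega χ x := mem_prodZeroSetOmega_of_mem_zeroSet χ hp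
    have hL1 : deriv x.ψ.LFunction p ≠ 0 :=
      deriv_LFunction_ne_zero_of_deriv_LL_ne_zero χ hD hχ x hL0 (h_ii p hpS')
    -- `g = dslope L p`, holomorphic, `g(p) = L′(p) ≠ 0`
    set g : ℂ → ℂ := dslope x.ψ.LFunction p with hg_def
    have hgdiff : DifferentiableOn ℂ g U :=
      (Complex.differentiableOn_dslope (hUo.mem_nhds hpU)).mpr hLdiff.differentiableOn
    have hgp : g p = deriv x.ψ.LFunction p := dslope_same _ _
    have hgne : {z | g z ≠ 0} ∈ 𝓝 p := by
      have hc : ContinuousAt g p := (hgdiff.differentiableAt (hUo.mem_nhds hpU)).continuousAt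
      exact hc.preimage_mem_nhds (isOpen_ne.mem_nhds (by rw [hgp]; exact hL1))
    set V : Set ℂ := U ∩ {z | g z ≠ 0} with hV_def
    have hV : V ∈ 𝓝 p := inter_mem (hUo.mem_nhds hpU) hgne
    refine ⟨fun z => N z * (g z)⁻¹, V, hV, ?_, ?_, ?_⟩
    · intro z hz
      obtain ⟨hzU, hgz⟩ := hz
      have hNd : DifferentiableAt ℂ N z := hNdiff.differentiableAt (hUo.mem_nhds hzU)
      have hgd : DifferentiableAt ℂ g z := hgdiff.differentiableAt (hUo.mem_nhds hzU)
      exact (hNd.mul (hgd.inv hgz)).differentiableWithinAt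
    · simp only [hgp, div_eq_mul_inv]
    · intro z hz hzp
      have hgz : g z = x.ψ.LFunction z / (z - p) := by
        rw [hg_def, dslope_of_ne _ hzp, slope_def_field, hL0, sub_zero]
      show F z = N z * (g z)⁻¹ / (z - p)
      rw [hF_def, hgz]
      have hzp' : z - p ≠ 0 := sub_ne_zero.mpr hzp
      by_cases hLz : x.ψ.LFunction z = 0
      · simp only [hLz]; simp
      · field_simp
  -- the residue theorem
  have hab : (1 : ℝ) / 2 - alpha D < 1 / 2 + alpha D := by linarith
  have hcd : T + Lm < T + Lp := by linarith
  have hSsub : (↑S : Set ℂ) ⊆ Ioo (1 / 2 - alpha D) (1 / 2 + alpha D) ×ℂ Ioo (T + Lm) (T + Lp) := by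
    intro p hp
    have hp' : p ∈ zeroSet D x := (hmemS p).mp (Finset.mem_coe.mp hp)
    obtain ⟨h1, h2, h3⟩ := hzeroR hp'
    rw [mem_reProdIm]
    have h1' := abs_lt.mp h1
    exact ⟨⟨by linarith [h1'.1], by linarith [h1'.2]⟩, ⟨h2, h3⟩⟩
  have key := rectBoundaryIntegral_eq_sum_of_simplePoles hab hcd S F
    (fun q => N q / deriv x.ψ.LFunction q) U hUo hKU hSsub hFdiff hpoles
  have h2πI : (2 * π * I : ℂ) ≠ 0 := by simp [Real.pi_ne_zero, I_ne_zero]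
  rw [rectIntegral, ← hT, key, ← mul_assoc, one_div_mul_cancel h2πI, one_mul]

end Residue

/-! ### B. The parameters for large `D` (copies of the private helpers of `Section8Eq81bEdge`) -/

/-- Sizes of `α` and `Cα` once `𝓛 ≥ 80`, `𝓛 ≥ 4π|C| + 1`: `0 < α = π/𝓛⁹ ≤ 1/100`, `|C|α ≤ ¼`
(private copy of `params81` / `Typed.Section17.alpha_sizes171`). [cite: Zhang2022LandauSiegel, §2 (2.10)] -/
private theorem alpha_sizes_eng {C : ℝ} {D : ℕ} (h80 : 80 ≤ ell D) (hC : 4 * π * |C| + 1 ≤ ell D) :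
    0 < alpha D ∧ alpha D = π / ell D ^ 9 ∧ alpha D ≤ 1 / 100 ∧ |C| * alpha D ≤ 1 / 4 := by
  have hπ := Real.pi_pos
  have hL0 : 0 < ell D := by linarith
  have hL1 : 1 ≤ ell D := by linarith
  have hα : alpha D = π / ell D ^ 9 := by rw [alpha, bigP, Real.log_exp]
  have hL9 : ell D ≤ ell D ^ 9 := by
    calc ell D = ell D ^ 1 := (pow_one _).symm
      _ ≤ ell D ^ 9 := pow_le_pow_right₀ hL1 (by norm_num)
  have hL9pos : 0 < ell D ^ 9 := by positivity
  have hα0 : 0 < alpha D := by rw [hα]; positivity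
  have hαL : alpha D ≤ π / ell D := by
    rw [hα]; exact div_le_div_of_nonneg_left hπ.le hL0 hL9
  have hα100 : alpha D ≤ 1 / 100 := by
    have hL2 : ell D ^ 2 ≤ ell D ^ 9 := pow_le_pow_right₀ hL1 (by norm_num)
    rw [hα, div_le_iff₀ hL9pos]; nlinarith [Real.pi_lt_four]
  have hCα : |C| * alpha D ≤ 1 / 4 := by
    have h1 : |C| * alpha D ≤ |C| * (π / ell D) := mul_le_mul_of_nonneg_left hαL (abs_nonneg C)
    have h2 : |C| * (π / ell D) ≤ 1 / 4 := by
      rw [← mul_div_assoc, div_le_iff₀ hL0]; nlinarith [abs_nonneg C]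
    exact h1.trans h2
  exact ⟨hα0, hα, hα100, hCα⟩

/-- The shift sizes once `𝓛 ≥ 80`, `𝓛 ≥ 5π|c′| + 1`: `|b₁|, |b₂|, |b₃| ≤ 4α` and `Im β₁, Im β₂, Im β₃ ≥ 0`
(`β_j = ib_j`, (2.13)). [cite: Zhang2022LandauSiegel, §2 (2.13)] -/
theorem shift_sizes_of_ell {c' : ℝ} {D : ℕ} (h80 : 80 ≤ ell D) (hc : 5 * π * |c'| + 1 ≤ ell D) :
    |b1 c' D| ≤ 4 * alpha D ∧ |b2 c' D| ≤ 4 * alpha D ∧ |b3 c' D| ≤ 4 * alpha D ∧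
      0 ≤ (beta1 c' D).im ∧ 0 ≤ (beta2 c' D).im ∧ 0 ≤ (beta3 c' D).im := by
  have hπ := Real.pi_pos
  have hL0 : 0 < ell D := by linarith
  have hL1 : 1 ≤ ell D := by linarith
  have hα : alpha D = π / ell D ^ 9 := by rw [alpha, bigP, Real.log_exp]
  have hL8 : ell D ≤ ell D ^ 8 := by
    calc ell D = ell D ^ 1 := (pow_one _).symm
      _ ≤ ell D ^ 8 := pow_le_pow_right₀ hL1 (by norm_num)
  have hα0 : 0 < alpha D := by rw [hα]; positivity
  have hαℓ : alpha D * ell D = π / ell D ^ 8 := by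
    rw [hα]; field_simp
  have hcαL : |c'| * (alpha D * ell D) ≤ 1 / 5 := by
    rw [hαℓ]
    have h1 : |c'| * (π / ell D ^ 8) ≤ |c'| * (π / ell D) :=
      mul_le_mul_of_nonneg_left (div_le_div_of_nonneg_left hπ.le hL0 hL8) (abs_nonneg c')
    have h2 : |c'| * (π / ell D) ≤ 1 / 5 := by
      rw [← mul_div_assoc, div_le_iff₀ hL0]; nlinarith [abs_nonneg c']
    exact h1.trans h2
  have habs : |c' * alpha D * ell D| ≤ 1 / 5 := by
    rw [mul_assoc, abs_mul, abs_of_nonneg (by positivity : 0 ≤ alpha D * ell D)]; exact hcαL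
  obtain ⟨hm1, hm2⟩ := abs_le.mp habs
  refine ⟨?_, ?_, ?_, ?_, ?_, ?_⟩
  · rw [b1, abs_mul, abs_of_pos hα0]
    have : |1 - 5 * c' * alpha D * ell D| ≤ 4 := by
      rw [abs_le]; constructor <;> nlinarith
    nlinarith
  · rw [b2, abs_mul, abs_mul, abs_of_pos hα0, abs_two]
    have : |1 + c' * alpha D * ell D| ≤ 2 := by
      rw [abs_le]; constructor <;> nlinarith
    nlinarith
  · rw [b3, abs_mul, abs_mul, abs_of_pos hα0, abs_of_pos (by norm_num : (0:ℝ) < 3)]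
    have : |1 - c' * alpha D * ell D| ≤ 4 / 3 := by
      rw [abs_le]; constructor <;> nlinarith
    nlinarith
  · have : (beta1 c' D).im = alpha D * (1 - 5 * c' * alpha D * ell D) := by simp [beta1]
    rw [this]; exact mul_nonneg hα0.le (by nlinarith)
  · have : (beta2 c' D).im = 2 * alpha D * (1 + c' * alpha D * ell D) := by simp [beta2]
    rw [this]; exact mul_nonneg (by positivity) (by nlinarith)
  · have : (beta3 c' D).im = 3 * alpha D * (1 - c' * alpha D * ell D) := by simp [beta3]
    rw [this]; exact mul_nonneg (by positivity) (by nlinarith)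

/-- The `t`-range of the contour pieces: `|t − 2π𝓛⁵¹⁹| ≤ 𝓛⁴⁰⁵ + 1`, `𝓛 ≥ 80` gives
`5𝓛⁵¹⁹ ≤ t ≤ 8𝓛⁵¹⁹` and `t ≥ 200` (copy of the private `trange81`, range widened to `+1`).
[cite: Zhang2022LandauSiegel, §2 (2.8)] -/
theorem trange_of_ell {L t : ℝ} (hL : 80 ≤ L) (ht : |t - 2 * π * L ^ 519| ≤ L ^ 405 + 1) :
    5 * L ^ 519 ≤ t ∧ t ≤ 8 * L ^ 519 ∧ 200 ≤ t := by
  have hL1 : 1 ≤ L := by linarith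
  have h114 : 9 ≤ L ^ 114 := by
    have h : L ^ 1 ≤ L ^ 114 := pow_le_pow_right₀ hL1 (by norm_num)
    rw [pow_one] at h; linarith
  have h405 : L ^ 405 + 1 ≤ L ^ 519 := by
    have h1 : (1 : ℝ) ≤ L ^ 405 := one_le_pow₀ hL1
    calc L ^ 405 + 1 ≤ L ^ 405 * 9 := by nlinarith
      _ ≤ L ^ 405 * L ^ 114 := by gcongr
      _ = L ^ 519 := by rw [← pow_add]
  have h519 : L ≤ L ^ 519 := by
    calc L = L ^ 1 := (pow_one _).symm
      _ ≤ L ^ 519 := pow_le_pow_right₀ hL1 (by norm_num)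
  obtain ⟨ht1, ht2⟩ := abs_le.mp ht
  have hπa : 3 * L ^ 519 ≤ π * L ^ 519 :=
    mul_le_mul_of_nonneg_right Real.pi_gt_three.le (by positivity)
  have hπb : π * L ^ 519 ≤ 3.15 * L ^ 519 :=
    mul_le_mul_of_nonneg_right Real.pi_lt_d2.le (by positivity)
  exact ⟨by linarith, by linarith, by linarith⟩

/-! ### C. Continuity of the generic integrand along the vertical lines -/

section Vertical

variable {D : ℕ} (x : Chr D)

omit x in
/-- Points `σ + iy` of the contour height range have `Im > 0` (indeed `y ≥ 5𝓛⁵¹⁹`).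
[cite: Zhang2022LandauSiegel, §2 (2.8)] -/
theorem im_pos_of_height {D : ℕ} (h80 : 80 ≤ ell D) {y : ℝ}
    (hy : y ∈ Icc (2 * π * t0 D - ell1 D - 1) (2 * π * t0 D + ell1 D + 1)) : 0 < y := by
  have hy' : |y - 2 * π * ell D ^ 519| ≤ ell D ^ 405 + 1 := by
    have e1 : t0 D = ell D ^ 519 := rfl
    have e2 : ell1 D = ell D ^ 405 := rfl
    rw [← e1, ← e2, abs_le]; constructor <;> linarith [hy.1, hy.2]
  linarith [(trange_of_ell h80 hy').2.2]

/-- Along `σ + iy` over a height set where `L(σ+iy,ψ) ≠ 0` and `y > 0`, the generic integrand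
`(L(s+β,ψ)/L(s,ψ))·G(s)·ω(s)` is continuous in `y`, for `G` holomorphic on `{Im s > 0}`
(`L`, `ω` entire). [cite: Zhang2022LandauSiegel, §8 (8.1) p. 42] -/
theorem continuousOn_lratio_vertical (β : ℂ) (G : ℂ → ℂ)
    (hG : DifferentiableOn ℂ G {s : ℂ | 0 < s.im}) (σ : ℝ) {S : Set ℝ}
    (hS : ∀ y ∈ S, 0 < y) (hL : ∀ y ∈ S, x.ψ.LFunction ((σ : ℂ) + y * I) ≠ 0) :
    ContinuousOn (fun y : ℝ => x.ψ.LFunction ((σ : ℂ) + y * I + β) / x.ψ.LFunction ((σ : ℂ) + y * I) *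
      G ((σ : ℂ) + y * I) * omegaW D ((σ : ℂ) + y * I)) S := by
  intro y hy
  apply ContinuousAt.continuousWithinAt
  have hopen : IsOpen {z : ℂ | 0 < z.im} := isOpen_lt continuous_const Complex.continuous_im
  have hLc : Continuous x.ψ.LFunction := Ded81Edge.continuous_LFunction_chr x
  have hline : Continuous fun y : ℝ => (σ : ℂ) + y * I := by fun_prop
  have h1 : ContinuousAt (fun y : ℝ => x.ψ.LFunction ((σ : ℂ) + y * I + β)) y :=
    (hLc.comp (hline.add continuous_const)).continuousAt
  have h2 : ContinuousAt (fun y : ℝ => x.ψ.LFunction ((σ : ℂ) + y * I)) y :=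
    (hLc.comp hline).continuousAt
  have hz : 0 < ((σ : ℂ) + (y : ℂ) * I).im := by simp; exact hS y hy
  have hGc : ContinuousAt G ((σ : ℂ) + y * I) :=
    (hG.differentiableAt (hopen.mem_nhds hz)).continuousAt
  have h3 : ContinuousAt (fun y : ℝ => G ((σ : ℂ) + y * I)) y := hGc.comp_of_eq hline.continuousAt rfl
  have h4 : ContinuousAt (fun y : ℝ => omegaW D ((σ : ℂ) + y * I)) y :=
    ((Ded81Edge.continuous_omega (ell2 D) (t0 D)).comp hline).continuousAt
  exact ((h1.div h2 (hL y hy)).mul h3).mul h4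

end Vertical

/-! ### D. The pointwise bound on the contour pieces -/

/-- On the boundary zone the generic integrand is at most `C₅₉·log P·G_b·e^{2−𝓛¹⁰/4}`, given
Lemma 5.9's bound for the ratio at `s`, `‖G(s)‖ ≤ G_b` and "a simple bound for `ω(s)`"
(`norm_omegaW_le_exp`). [cite: Zhang2022LandauSiegel, §8 (8.1) p. 42, tex L2203–L2205] -/
theorem norm_lratio_integrand_le {D : ℕ} (x : Chr D) (hL2 : 2 ≤ ell D) (hα1 : alpha D ≤ 1)
    {β : ℂ} {G : ℂ → ℂ} {C₅₉ Gb : ℝ} {s : ℂ}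
    (hσ : |s.re - 1 / 2| ≤ alpha D) (ht1 : ell1 D - 1 ≤ |s.im - 2 * π * t0 D|)
    (h59 : ‖x.ψ.LFunction (s + β) / x.ψ.LFunction s‖ ≤ C₅₉ * Real.log (bigP D))
    (hGs : ‖G s‖ ≤ Gb) :
    ‖x.ψ.LFunction (s + β) / x.ψ.LFunction s * G s * omegaW D s‖ ≤
      C₅₉ * Real.log (bigP D) * Gb * Real.exp (2 - ell D ^ 10 / 4) := by
  have hω := norm_omegaW_le_exp hL2 (hσ.trans hα1) ht1
  have hA0 : 0 ≤ C₅₉ * Real.log (bigP D) := (norm_nonneg _).trans h59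
  have hG0 : 0 ≤ Gb := (norm_nonneg _).trans hGs
  rw [norm_mul, norm_mul]
  exact mul_le_mul (mul_le_mul h59 hGs (norm_nonneg _) hA0) hω (norm_nonneg _) (mul_nonneg hA0 hG0)

/-! ### E. The contour remainder for the generic integrand (adapted from `eq81b_of_prop22`) -/

/-- `‖1/(2πi)‖ ≤ 1/6` and `‖1/2π‖ ≤ 1/6`. [folklore] -/
private theorem norm_prefactors_le' :
    ‖(1 / (2 * π * I) : ℂ)‖ ≤ 1 / 6 ∧ ‖(1 / (2 * π) : ℂ)‖ ≤ 1 / 6 := by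
  have hπ := Real.pi_gt_three
  have h1 : ‖(1 / (2 * π) : ℂ)‖ = 1 / (2 * π) := by
    rw [show (1 / (2 * π) : ℂ) = ((1 / (2 * π) : ℝ) : ℂ) by push_cast; ring, Complex.norm_real,
      Real.norm_of_nonneg (by positivity)]
  have h2 : ‖(1 / (2 * π * I) : ℂ)‖ = 1 / (2 * π) := by
    rw [norm_div, norm_mul, Complex.norm_I, mul_one, norm_one,
      show (2 * π : ℂ) = ((2 * π : ℝ) : ℂ) by push_cast; ring, Complex.norm_real,
      Real.norm_of_nonneg (by positivity)]
  have h3 : 1 / (2 * π) ≤ (1 : ℝ) / 6 := by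
    rw [div_le_div_iff₀ (by positivity) (by norm_num)]; linarith
  exact ⟨h2 ▸ h3, h1 ▸ h3⟩

/-- A horizontal edge at height `T + L′` with `𝓛₁ − 1 ≤ |L′| ≤ 𝓛₁ + ¼` contributes at most `M·2α`
once the integrand is `≤ M` on the pieces (abstract bookkeeping; `P` = the clearance predicate).
[cite: Zhang2022LandauSiegel, §8 (8.1) p. 42] -/
private theorem norm_integral_horizontal' {F : ℂ → ℂ} {P : ℂ → Prop} {M α T L' ℓ : ℝ}
    (hα : 0 ≤ α)
    (hMs : ∀ s : ℂ, |s.re - 1 / 2| ≤ α → ℓ - 1 ≤ |s.im - T| → |s.im - T| ≤ ℓ + 1 / 4 → P s →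
      ‖F s‖ ≤ M)
    (hL'1 : |L'| ≤ ℓ + 1 / 4) (hL'2 : ℓ - 1 ≤ |L'|)
    (hP : ∀ s : ℂ, |s.re - 1 / 2| ≤ α → s.im = T + L' → P s) :
    ‖∫ u in (1 / 2 - α)..(1 / 2 + α), F (u + ((T + L' : ℝ) : ℂ) * I)‖ ≤
      M * |1 / 2 + α - (1 / 2 - α)| := by
  refine intervalIntegral.norm_integral_le_of_norm_le_const fun u hu => ?_
  rw [Set.uIoc_of_le (by linarith : 1 / 2 - α ≤ 1 / 2 + α)] at hu
  have hre : ((u : ℂ) + ((T + L' : ℝ) : ℂ) * I).re = u := by simp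
  have him : ((u : ℂ) + ((T + L' : ℝ) : ℂ) * I).im = T + L' := by simp
  have hσ : |((u : ℂ) + ((T + L' : ℝ) : ℂ) * I).re - 1 / 2| ≤ α := by
    rw [hre, abs_le]; constructor <;> linarith [hu.1, hu.2]
  exact hMs _ hσ (by rw [him, add_sub_cancel_left]; exact hL'2)
    (by rw [him, add_sub_cancel_left]; exact hL'1) (hP _ hσ him)

/-- A vertical sliver on `σ` (`|σ − ½| = α`) between heights `u`, `v` on the same side of `T` with
`𝓛₁ − ¼ ≤ |u − T|, |v − T| ≤ 𝓛₁ + ¼` contributes at most `M·|v − u|` (abstract bookkeeping).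
[cite: Zhang2022LandauSiegel, §8 (8.1) p. 42] -/
private theorem norm_integral_vertical' {F : ℂ → ℂ} {P : ℂ → Prop} {M α T ℓ σ u v : ℝ}
    (hMs : ∀ s : ℂ, |s.re - 1 / 2| ≤ α → ℓ - 1 ≤ |s.im - T| → |s.im - T| ≤ ℓ + 1 / 4 → P s →
      ‖F s‖ ≤ M)
    (hσ : |σ - 1 / 2| = α)
    (hu1 : ℓ - 1 / 4 ≤ |u - T|) (hu2 : |u - T| ≤ ℓ + 1 / 4)
    (hv1 : ℓ - 1 / 4 ≤ |v - T|) (hv2 : |v - T| ≤ ℓ + 1 / 4)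
    (hside : (0 ≤ u - T ∧ 0 ≤ v - T) ∨ (u - T ≤ 0 ∧ v - T ≤ 0))
    (hP : ∀ s : ℂ, |s.re - 1 / 2| = α → |s.im - T| ≤ ℓ + 1 → P s) :
    ‖∫ y in u..v, F ((σ : ℂ) + y * I)‖ ≤ M * |v - u| := by
  refine intervalIntegral.norm_integral_le_of_norm_le_const fun y hy => ?_
  have hre : ((σ : ℂ) + y * I).re = σ := by simp
  have him : ((σ : ℂ) + y * I).im = y := by simp
  have hy' : ℓ - 1 / 4 ≤ |y - T| ∧ |y - T| ≤ ℓ + 1 / 4 := by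
    rw [Set.mem_uIoc] at hy
    rcases hside with ⟨hu0, hv0⟩ | ⟨hu0, hv0⟩
    · rw [abs_of_nonneg hu0] at hu1 hu2
      rw [abs_of_nonneg hv0] at hv1 hv2
      rcases hy with ⟨hy1, hy2⟩ | ⟨hy1, hy2⟩
      · rw [abs_of_nonneg (by linarith)]; constructor <;> linarith
      · rw [abs_of_nonneg (by linarith)]; constructor <;> linarith
    · rw [abs_of_nonpos hu0] at hu1 hu2
      rw [abs_of_nonpos hv0] at hv1 hv2
      rcases hy with ⟨hy1, hy2⟩ | ⟨hy1, hy2⟩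
      · rw [abs_of_nonpos (by linarith)]; constructor <;> linarith
      · rw [abs_of_nonpos (by linarith)]; constructor <;> linarith
  exact hMs _ (by rw [hre, hσ]) (by rw [him]; linarith [hy'.1]) (by rw [him]; exact hy'.2)
    (hP _ (by rw [hre, hσ]) (by rw [him]; linarith [hy'.2]))

/-- The final arithmetic: six pieces of size `≤ M/4` each, weighted by `‖1/2πi‖, ‖1/2π‖ ≤ 1/6`,
total at most `M`. [folklore] -/
private theorem six_pieces_le' {k m Hc Hd Pb Qb Pa Qa : ℂ} {M l₁ l₂ l₃ : ℝ} (hM : 0 ≤ M)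
    (hk : ‖k‖ ≤ 1 / 6) (hm : ‖m‖ ≤ 1 / 6)
    (hHc : ‖Hc‖ ≤ M * l₁) (hHd : ‖Hd‖ ≤ M * l₁) (hPb : ‖Pb‖ ≤ M * l₂) (hQb : ‖Qb‖ ≤ M * l₃)
    (hPa : ‖Pa‖ ≤ M * l₂) (hQa : ‖Qa‖ ≤ M * l₃)
    (hl₁ : l₁ ≤ 1 / 4) (hl₂ : l₂ ≤ 1 / 4) (hl₃ : l₃ ≤ 1 / 4) :
    ‖k * (Hc - Hd) + m * (Pb - Qb) - m * (Pa - Qa)‖ ≤ M := by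
  have h1 : ‖k * (Hc - Hd)‖ ≤ 1 / 6 * (M / 4 + M / 4) := by
    rw [norm_mul]
    exact mul_le_mul hk ((norm_sub_le _ _).trans (add_le_add (by nlinarith) (by nlinarith)))
      (norm_nonneg _) (by norm_num)
  have h2 : ‖m * (Pb - Qb)‖ ≤ 1 / 6 * (M / 4 + M / 4) := by
    rw [norm_mul]
    exact mul_le_mul hm ((norm_sub_le _ _).trans (add_le_add (by nlinarith) (by nlinarith)))
      (norm_nonneg _) (by norm_num)
  have h3 : ‖m * (Pa - Qa)‖ ≤ 1 / 6 * (M / 4 + M / 4) := by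
    rw [norm_mul]
    exact mul_le_mul hm ((norm_sub_le _ _).trans (add_le_add (by nlinarith) (by nlinarith)))
      (norm_nonneg _) (by norm_num)
  calc ‖k * (Hc - Hd) + m * (Pb - Qb) - m * (Pa - Qa)‖
      ≤ ‖k * (Hc - Hd) + m * (Pb - Qb)‖ + ‖m * (Pa - Qa)‖ := norm_sub_le _ _
    _ ≤ ‖k * (Hc - Hd)‖ + ‖m * (Pb - Qb)‖ + ‖m * (Pa - Qa)‖ :=
        add_le_add (norm_add_le _ _) le_rfl
    _ ≤ 1 / 6 * (M / 4 + M / 4) + 1 / 6 * (M / 4 + M / 4) + 1 / 6 * (M / 4 + M / 4) := by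
        linarith
    _ ≤ M := by linarith

set_option maxHeartbeats 400000 in
/-- **The contour remainder of (8.1) for the generic integrand** `F = (L(s+β,ψ)/L(s,ψ))·G(s)·ω(s)`:
at one character `ψ` whose `Ω`-zeros lie on the critical line (Prop. 2.2 (i) at `ψ`) and one
admissible rectangle, with Lemma 5.9's bound `‖L(s+β)/L(s)‖ ≤ C₅₉ log P` available on
`|σ − ½| ≤ α`, `|t − 2πt₀| ≤ 𝓛₁ + ¼` at clearance `min(c₀,1)·α`, and `‖G‖ ≤ G_b` on the boundary
zone (`G` holomorphic on `{Im s > 0}`): `‖(1/2πi)∮_{∂ℜ}F − ((1/2πi)∫_{𝔍(α)}F − (1/2πi)∫_{𝔍(−α)}F)‖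
≤ C₅₉·log P·G_b·e^{2−𝓛¹⁰/4}` — the two horizontal edges (length `2α`) and four vertical slivers
(length `≤ |C|α ≤ ¼`) all lie at heights `|t − 2πt₀| ≥ 𝓛₁ − 1`, where `|ω| ≤ e^{2−𝓛¹⁰/4}`.
[cite: Zhang2022LandauSiegel, §8 (8.1) p. 42, tex L2203–L2205] -/
theorem norm_rectIntegral_sub_segInt_le_of_bound {D : ℕ} [NeZero D] {χ : DirichletCharacter ℂ D}
    (x : Chr D) {C c₀ c₁ Lm Lp C₅₉ Gb : ℝ} (hc₁ : 0 < c₁) (hc₁c₀ : c₁ ≤ c₀) (hc₁1 : c₁ ≤ 1)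
    (h80 : 80 ≤ ell D) (hCL : 4 * π * |C| + 1 ≤ ell D)
    (h22x : ∀ s ∈ prodZeroSetOmega χ x, s.re = 1 / 2)
    (β : ℂ)
    (h59 : ∀ s : ℂ, |s.re - 1 / 2| ≤ alpha D → |s.im - 2 * π * t0 D| ≤ ell1 D + 1 / 4 →
      (∀ ρ : ℂ, x.ψ.LFunction ρ = 0 → c₁ * alpha D ≤ ‖s - ρ‖) →
        ‖x.ψ.LFunction (s + β) / x.ψ.LFunction s‖ ≤ C₅₉ * Real.log (bigP D))
    (hR : AdmRect D x C c₀ Lm Lp)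
    (G : ℂ → ℂ) (hG : DifferentiableOn ℂ G {s : ℂ | 0 < s.im})
    (hGb : ∀ s : ℂ, |s.re - 1 / 2| ≤ alpha D → ell1 D - 1 ≤ |s.im - 2 * π * t0 D| →
      |s.im - 2 * π * t0 D| ≤ ell1 D + 1 / 4 → ‖G s‖ ≤ Gb) :
    ‖rectIntegral D Lm Lp
          (fun s => x.ψ.LFunction (s + β) / x.ψ.LFunction s * G s * omegaW D s) -
        (Lemma81.segInt (t0 D) (ell1 D) ((alpha D : ℝ) : ℂ)
            (fun s => x.ψ.LFunction (s + β) / x.ψ.LFunction s * G s * omegaW D s) -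
          Lemma81.segInt (t0 D) (ell1 D) ((-alpha D : ℝ) : ℂ)
            (fun s => x.ψ.LFunction (s + β) / x.ψ.LFunction s * G s * omegaW D s))‖ ≤
      C₅₉ * Real.log (bigP D) * Gb * Real.exp (2 - ell D ^ 10 / 4) := by
  set F : ℂ → ℂ := fun s => x.ψ.LFunction (s + β) / x.ψ.LFunction s * G s * omegaW D s with hF
  obtain ⟨hα0, -, hα100, hCα⟩ := alpha_sizes_eng h80 hCL
  have hα4 : alpha D ≤ 1 / 4 := by linarith
  have hα1 : alpha D ≤ 1 := by linarith
  have hL2 : 2 ≤ ell D := by linarith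
  have hℓ1 : (1 : ℝ) ≤ ell1 D := by rw [ell1]; exact one_le_pow₀ (by linarith)
  set M : ℝ := C₅₉ * Real.log (bigP D) * Gb * Real.exp (2 - ell D ^ 10 / 4) with hMdef
  -- the admissible rectangle
  obtain ⟨hLp, hLm, -, hclear⟩ := hR
  have hCα' : C * alpha D ≤ 1 / 4 :=
    le_trans (mul_le_mul_of_nonneg_right (le_abs_self C) hα0.le) hCα
  obtain ⟨hLp1, hLp2⟩ := abs_le.mp (hLp.trans hCα')
  obtain ⟨hLm1, hLm2⟩ := abs_le.mp (hLm.trans hCα')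
  -- (1) the pointwise bound `M` on the pieces, with the clearance predicate `P`
  have hMs : ∀ s : ℂ, |s.re - 1 / 2| ≤ alpha D → ell1 D - 1 ≤ |s.im - 2 * π * t0 D| →
      |s.im - 2 * π * t0 D| ≤ ell1 D + 1 / 4 →
      (∀ ρ : ℂ, x.ψ.LFunction ρ = 0 → c₁ * alpha D ≤ ‖s - ρ‖) →
      ‖F s‖ ≤ M := by
    intro s hσ ht1 ht2 hcl
    exact norm_lratio_integrand_le x hL2 hα1 hσ ht1 (h59 s hσ ht2 hcl) (hGb s hσ ht1 ht2)
  -- nonnegativity of `M` (the zone is nonempty: the corner `½ + α + i(T + Lp)` lies in it)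
  have hM0 : 0 ≤ M := by
    set s₁ : ℂ := ((1 / 2 + alpha D : ℝ) : ℂ) + ((2 * π * t0 D + Lp : ℝ) : ℂ) * I with hs₁
    have hre : s₁.re = 1 / 2 + alpha D := by simp [hs₁]
    have him : s₁.im = 2 * π * t0 D + Lp := by simp [hs₁]
    have hσ : |s₁.re - 1 / 2| ≤ alpha D := by
      rw [hre, add_sub_cancel_left, abs_of_pos hα0]
    have ht : |s₁.im - 2 * π * t0 D| = Lp := by
      rw [him, add_sub_cancel_left, abs_of_nonneg (by linarith)]
    have hon : s₁ ∈ onBoundaryR D Lm Lp := by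
      refine ⟨⟨hσ, by rw [him]; linarith, by rw [him]⟩, fun hin => ?_⟩
      exact absurd hin.2.2 (by rw [him]; exact lt_irrefl _)
    have hcl : ∀ ρ : ℂ, x.ψ.LFunction ρ = 0 → c₁ * alpha D ≤ ‖s₁ - ρ‖ := fun ρ hρ =>
      le_trans (mul_le_mul_of_nonneg_right hc₁c₀ hα0.le) (hclear s₁ hon ρ hρ)
    exact (norm_nonneg _).trans (hMs s₁ hσ (by rw [ht]; linarith) (by rw [ht]; linarith) hcl)
  -- (2) the clearance: on `∂ℜ` by admissibility, on `σ = ½ ± α` by Prop. 2.2 (i)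
  have hclV : ∀ s : ℂ, |s.re - 1 / 2| = alpha D → |s.im - 2 * π * t0 D| ≤ ell1 D + 1 →
      ∀ ρ : ℂ, x.ψ.LFunction ρ = 0 → c₁ * alpha D ≤ ‖s - ρ‖ := by
    intro s hσ ht ρ hρ
    have h := clearance_of_prop22i h22x hα4 hσ ht ρ hρ
    exact le_trans (mul_le_of_le_one_left hα0.le hc₁1) h
  have hclH : ∀ L' : ℝ, (L' = Lm ∨ L' = Lp) → ∀ s : ℂ, |s.re - 1 / 2| ≤ alpha D →
      s.im = 2 * π * t0 D + L' →
      ∀ ρ : ℂ, x.ψ.LFunction ρ = 0 → c₁ * alpha D ≤ ‖s - ρ‖ := by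
    intro L' hL' s hs1 hs2 ρ hρ
    have hon : s ∈ onBoundaryR D Lm Lp := by
      refine ⟨⟨hs1, ?_, ?_⟩, ?_⟩
      · rcases hL' with rfl | rfl <;> linarith
      · rcases hL' with rfl | rfl <;> linarith
      · intro hin
        rcases hL' with rfl | rfl
        · exact absurd hin.2.1 (by rw [hs2]; exact lt_irrefl _)
        · exact absurd hin.2.2 (by rw [hs2]; exact lt_irrefl _)
    exact le_trans (mul_le_mul_of_nonneg_right hc₁c₀ hα0.le) (hclear s hon ρ hρ)
  -- (3) continuity along `σ = ½ ± α` on `[T − 𝓛₁ − 1, T + 𝓛₁ + 1]` (no zero there, by (2))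
  have hcontV : ∀ σ : ℝ, |σ - 1 / 2| = alpha D →
      ContinuousOn (fun y : ℝ => F ((σ : ℂ) + y * I))
        (Icc (2 * π * t0 D - ell1 D - 1) (2 * π * t0 D + ell1 D + 1)) := by
    intro σ hσ
    have h := continuousOn_lratio_vertical x β G hG σ
      (S := Icc (2 * π * t0 D - ell1 D - 1) (2 * π * t0 D + ell1 D + 1))
      (fun y hy => im_pos_of_height h80 hy) (fun y hy => ?_)
    · simpa only [hF] using h
    · intro h0
      have hy' : |((σ : ℂ) + y * I).im - 2 * π * t0 D| ≤ ell1 D + 1 := by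
        have : ((σ : ℂ) + y * I).im = y := by simp
        rw [this, abs_le]; constructor <;> linarith [hy.1, hy.2]
      have h := hclV ((σ : ℂ) + y * I) (by simpa using hσ) hy' _ h0
      rw [sub_self, norm_zero] at h
      linarith [mul_pos hc₁ hα0]
  have hσb : |1 / 2 + alpha D - 1 / 2| = alpha D := by rw [add_sub_cancel_left, abs_of_pos hα0]
  have hσa : |1 / 2 - alpha D - 1 / 2| = alpha D := by
    rw [sub_sub_cancel_left, abs_neg, abs_of_pos hα0]
  -- (4) the contour identity
  have hE := rectIntegral_sub_segInt_eq F Lm Lp _ _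
    (hcontV _ hσb) (hcontV _ hσa) (by constructor <;> linarith) (by constructor <;> linarith)
    (by constructor <;> linarith) (by constructor <;> linarith)
  rw [hE]
  -- (5) the six pieces
  have hT1 : ∀ u : ℝ, 2 * π * t0 D + u - 2 * π * t0 D = u := fun u => by ring
  have hT2 : 2 * π * t0 D - ell1 D - 2 * π * t0 D = -ell1 D := by ring
  have hLmA : |Lm| ≤ ell1 D + 1 / 4 ∧ ell1 D - 1 / 4 ≤ |Lm| := by
    rw [abs_of_nonpos (by linarith)]; constructor <;> linarith
  have hLpA : |Lp| ≤ ell1 D + 1 / 4 ∧ ell1 D - 1 / 4 ≤ |Lp| := by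
    rw [abs_of_nonneg (by linarith)]; constructor <;> linarith
  have hℓA : |ell1 D| = ell1 D := abs_of_nonneg (by linarith)
  have hℓA' : |(-ell1 D)| = ell1 D := by rw [abs_neg, hℓA]
  have hq1 : ell1 D - 1 / 4 ≤ ell1 D := by linarith
  have hq2 : ell1 D ≤ ell1 D + 1 / 4 := by linarith
  have hHc := norm_integral_horizontal' (L' := Lm) hα0.le hMs hLmA.1 (by linarith [hLmA.2])
    (hclH Lm (Or.inl rfl))
  have hHd := norm_integral_horizontal' (L' := Lp) hα0.le hMs hLpA.1 (by linarith [hLpA.2])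
    (hclH Lp (Or.inr rfl))
  have hPb := norm_integral_vertical' (u := 2 * π * t0 D + Lm) (v := 2 * π * t0 D - ell1 D)
    hMs hσb (by rw [hT1]; exact hLmA.2) (by rw [hT1]; exact hLmA.1) (by rw [hT2, hℓA']; exact hq1)
    (by rw [hT2, hℓA']; exact hq2) (Or.inr ⟨by rw [hT1]; linarith, by rw [hT2]; linarith⟩) hclV
  have hQb := norm_integral_vertical' (u := 2 * π * t0 D + Lp) (v := 2 * π * t0 D + ell1 D)
    hMs hσb (by rw [hT1]; exact hLpA.2) (by rw [hT1]; exact hLpA.1) (by rw [hT1, hℓA]; exact hq1)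
    (by rw [hT1, hℓA]; exact hq2) (Or.inl ⟨by rw [hT1]; linarith, by rw [hT1]; linarith⟩) hclV
  have hPa := norm_integral_vertical' (u := 2 * π * t0 D + Lm) (v := 2 * π * t0 D - ell1 D)
    hMs hσa (by rw [hT1]; exact hLmA.2) (by rw [hT1]; exact hLmA.1) (by rw [hT2, hℓA']; exact hq1)
    (by rw [hT2, hℓA']; exact hq2) (Or.inr ⟨by rw [hT1]; linarith, by rw [hT2]; linarith⟩) hclV
  have hQa := norm_integral_vertical' (u := 2 * π * t0 D + Lp) (v := 2 * π * t0 D + ell1 D)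
    hMs hσa (by rw [hT1]; exact hLpA.2) (by rw [hT1]; exact hLpA.1) (by rw [hT1, hℓA]; exact hq1)
    (by rw [hT1, hℓA]; exact hq2) (Or.inl ⟨by rw [hT1]; linarith, by rw [hT1]; linarith⟩) hclV
  -- lengths and prefactors
  have hlenH : |1 / 2 + alpha D - (1 / 2 - alpha D)| ≤ 1 / 4 := by
    rw [show 1 / 2 + alpha D - (1 / 2 - alpha D) = 2 * alpha D by ring, abs_of_pos (by positivity)]
    linarith
  have hlen1 : |2 * π * t0 D - ell1 D - (2 * π * t0 D + Lm)| ≤ 1 / 4 := by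
    rw [show 2 * π * t0 D - ell1 D - (2 * π * t0 D + Lm) = -(Lm + ell1 D) by ring, abs_neg]
    exact hLm.trans hCα'
  have hlen2 : |2 * π * t0 D + ell1 D - (2 * π * t0 D + Lp)| ≤ 1 / 4 := by
    rw [show 2 * π * t0 D + ell1 D - (2 * π * t0 D + Lp) = -(Lp - ell1 D) by ring, abs_neg]
    exact hLp.trans hCα'
  obtain ⟨hk, hm⟩ := norm_prefactors_le'
  -- (6) assemble
  exact six_pieces_le' hM0 hk hm hHc hHd hPb hQb hPa hQa hlenH hlen1 hlen2

/-! ### F. The packaged engine: Proposition 2.2 ⇒ residue identity + contour remainder, all `G` -/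

/-- The size bookkeeping of the remainder: for `𝓛 ≥ 80`, `𝓛 ≥ 8(|κ| + 1)`,
`𝓛⁹·e^{κ𝓛⁹}·e^{2−𝓛¹⁰/4} ≤ e²·e^{−𝓛¹⁰/8}` — the "`O(ε)`, `ε = exp{−c𝓛¹⁰}`" bookkeeping of
(8.1) (`log P = 𝓛⁹`, `𝓛₁² = 𝓛₂²𝓛¹⁰`). [cite: Zhang2022LandauSiegel, §8 (8.1) p. 42, tex L2203–L2205] -/
theorem envelope_of_ell {L κ : ℝ} (hL : 80 ≤ L) (hκ : 8 * (|κ| + 1) ≤ L) :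
    L ^ 9 * Real.exp (κ * L ^ 9) * Real.exp (2 - L ^ 10 / 4) ≤
      Real.exp 2 * Real.exp (-(L ^ 10 / 8)) := by
  have hL0 : 0 < L := by linarith
  have h9 : 0 < L ^ 9 := by positivity
  have h1 : L ^ 9 ≤ Real.exp (L ^ 9) := by linarith [Real.add_one_le_exp (L ^ 9)]
  have hκ' : κ * L ^ 9 ≤ |κ| * L ^ 9 := mul_le_mul_of_nonneg_right (le_abs_self κ) h9.le
  calc L ^ 9 * Real.exp (κ * L ^ 9) * Real.exp (2 - L ^ 10 / 4)
      ≤ Real.exp (L ^ 9) * Real.exp (|κ| * L ^ 9) * Real.exp (2 - L ^ 10 / 4) := by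
        gcongr
    _ = Real.exp (L ^ 9 + |κ| * L ^ 9 + (2 - L ^ 10 / 4)) := by rw [Real.exp_add, Real.exp_add]
    _ ≤ Real.exp (2 + -(L ^ 10 / 8)) := by
        refine Real.exp_le_exp.mpr ?_
        have h10 : L ^ 10 = L ^ 9 * L := by ring
        rw [h10]
        nlinarith [mul_le_mul_of_nonneg_right hκ h9.le, abs_nonneg κ]
    _ = Real.exp 2 * Real.exp (-(L ^ 10 / 8)) := by rw [Real.exp_add]

/-- Monotonicity of admissibility in the clearance constant: a `c₀α`-cleared rectangle is
`c₁α`-cleared for `c₁ ≤ c₀` (`α ≥ 0`). [cite: Zhang2022LandauSiegel, §8 p. 42, tex L2197–L2201] -/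
theorem admRect_mono_clearance {D : ℕ} {x : Chr D} {C c₀ c₁ Lm Lp : ℝ} (hα : 0 ≤ alpha D)
    (h : c₁ ≤ c₀) (hR : AdmRect D x C c₀ Lm Lp) : AdmRect D x C c₁ Lm Lp := by
  obtain ⟨h1, h2, h3, h4⟩ := hR
  exact ⟨h1, h2, h3, fun s hs ρ hρ =>
    le_trans (mul_le_mul_of_nonneg_right h hα) (h4 s hs ρ hρ)⟩

set_option maxHeartbeats 400000 in
/-- **The (8.1)-type residue + contour-remainder engine, packaged** ("By Proposition 2.2 … by Lemma 5.9,
the residue theorem and a simple bound for `ω(s)`, `Σ_ρ … = Ĩ⁺ − Ĩ⁻ + O(ε)`", abstract form): for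
`c′ ≥ 0` with `Skeleton.Prop22 c′` and any growth exponent `κ`, there is `C′` such that for all large
`D` (threshold depending on `c′`, `κ` and the admissibility constants of `Z22:§8.u003` only), every
`ψ ∈ Ψ₁` and EVERY `G` holomorphic on `{Im s > 0}` with `‖G(s)‖ ≤ e^{κ𝓛⁹}` on the boundary zone
`|σ − ½| ≤ α`, `𝓛₁ − 1 ≤ |t − 2πt₀| ≤ 𝓛₁ + ¼`:
`‖Σ_{ρ∈𝔷(ψ)} (L(ρ+β₁,ψ)/L′(ρ,ψ))G(ρ)ω(ρ) − ((1/2πi)∫_{𝔍(α)}F − (1/2πi)∫_{𝔍(−α)}F)‖ ≤ C′e^{−𝓛¹⁰/8}`,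
`F(s) = (L(s+β₁,ψ)/L(s,ψ))G(s)ω(s)`, with `C′ = (|C₅₉| + 1)e²`. Inputs, all consequences of
`Prop22 c′` and tree theorems: the admissible rectangle (`step8u003_of_prop22`), the residue
identity (`sum_div_deriv_LFunction_eq_rectIntegral`, Prop. 2.2 (ii)), Lemma 5.9 on its use-range
(`lemma59_restricted_of_prop22`), the remainder (`norm_rectIntegral_sub_segInt_le_of_bound`,
Prop. 2.2 (i)). [cite: Zhang2022LandauSiegel, §8 (8.1) p. 42, tex L2197–L2206] -/
theorem lratio_residue_edge_of_prop22 {c' : ℝ} (hc' : 0 ≤ c') (h22 : Prop22 c') (κ : ℝ) :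
    ∃ C' : ℝ, ForAllLarge fun D _ χ => AssumptionA D χ → ∀ x ∈ PsiOne χ, ∀ G : ℂ → ℂ,
      DifferentiableOn ℂ G {s : ℂ | 0 < s.im} →
      (∀ s : ℂ, |s.re - 1 / 2| ≤ alpha D → ell1 D - 1 ≤ |s.im - 2 * π * t0 D| →
          |s.im - 2 * π * t0 D| ≤ ell1 D + 1 / 4 → ‖G s‖ ≤ Real.exp (κ * ell D ^ 9)) →
      ‖(∑ ρ ∈ finsetOf (zeroSet D x),
            x.ψ.LFunction (ρ + beta1 c' D) / deriv x.ψ.LFunction ρ * G ρ * omegaW D ρ) -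
          (Lemma81.segInt (t0 D) (ell1 D) ((alpha D : ℝ) : ℂ)
              (fun s => x.ψ.LFunction (s + beta1 c' D) / x.ψ.LFunction s * G s * omegaW D s) -
            Lemma81.segInt (t0 D) (ell1 D) ((-alpha D : ℝ) : ℂ)
              (fun s => x.ψ.LFunction (s + beta1 c' D) / x.ψ.LFunction s * G s * omegaW D s))‖ ≤
        C' * Real.exp (-(ell D ^ 10 / 8)) := by
  obtain ⟨Cadm, c₀, hc₀, D₃, hadm⟩ := step8u003_of_prop22 hc' h22
  have hc₁ : 0 < min c₀ 1 := lt_min hc₀ one_pos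
  obtain ⟨C₅₉, D₅₉, h59⟩ := lemma59_restricted_of_prop22 hc' h22 (min c₀ 1) hc₁
  obtain ⟨D₂₂, h22i⟩ := h22.1
  obtain ⟨D₂, h22ii⟩ := h22.2.1
  set L₀ : ℝ := max 80 (max (5 * π * |c'| + 1) (max (4 * π * |Cadm| + 1) (8 * (|κ| + 1)))) with hL₀
  refine ⟨(|C₅₉| + 1) * Real.exp 2,
    max (max (max D₃ D₅₉) (max D₂₂ D₂)) (max 3 ⌈Real.exp L₀⌉₊), ?_⟩
  intro D _ χ hD hq hp hA x hx G hG hGb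
  -- thresholds
  have hDa : max (max D₃ D₅₉) (max D₂₂ D₂) ≤ D := le_trans (le_max_left _ _) hD
  have hDb : max 3 ⌈Real.exp L₀⌉₊ ≤ D := le_trans (le_max_right _ _) hD
  have hD3' : D₃ ≤ D := le_trans (le_trans (le_max_left _ _) (le_max_left _ _)) hDa
  have hD59 : D₅₉ ≤ D := le_trans (le_trans (le_max_right _ _) (le_max_left _ _)) hDa
  have hD22 : D₂₂ ≤ D := le_trans (le_trans (le_max_left _ _) (le_max_right _ _)) hDa
  have hD2 : D₂ ≤ D := le_trans (le_trans (le_max_right _ _) (le_max_right _ _)) hDa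
  have hD3 : 3 ≤ D := le_trans (le_max_left _ _) hDb
  have hDℓ : ⌈Real.exp L₀⌉₊ ≤ D := le_trans (le_max_right _ _) hDb
  have hL : L₀ ≤ ell D := Section4.le_ell_of_ceil_exp_le hDℓ
  have h80 : 80 ≤ ell D := (le_max_left _ _).trans hL
  have hcL : 5 * π * |c'| + 1 ≤ ell D := ((le_max_left _ _).trans (le_max_right _ _)).trans hL
  have hCL : 4 * π * |Cadm| + 1 ≤ ell D :=
    (((le_max_left _ _).trans (le_max_right _ _)).trans (le_max_right _ _)).trans hL
  have hκL : 8 * (|κ| + 1) ≤ ell D :=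
    (((le_max_right _ _).trans (le_max_right _ _)).trans (le_max_right _ _)).trans hL
  obtain ⟨hα0, hα, hα100, hCα⟩ := alpha_sizes_eng h80 hCL
  obtain ⟨-, -, -, hb1, -, -⟩ := shift_sizes_of_ell h80 hcL
  -- the admissible rectangle of `ψ`, with clearance weakened to `min(c₀,1)·α`
  obtain ⟨Lm, Lp, hR0⟩ := hadm D χ hD3' hq hp hA x hx
  have hR : AdmRect D x Cadm (min c₀ 1) Lm Lp := admRect_mono_clearance hα0.le (min_le_left _ _) hR0
  have hLp := hR.1
  have hLm := hR.2.1
  have hCabs : Cadm * alpha D ≤ 1 / 4 :=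
    le_trans (mul_le_mul_of_nonneg_right (le_abs_self Cadm) hα0.le) hCα
  obtain ⟨hLp1, hLp2⟩ := abs_le.mp (hLp.trans hCabs)
  obtain ⟨hLm1, hLm2⟩ := abs_le.mp (hLm.trans hCabs)
  have hℓ1 : (1 : ℝ) ≤ ell1 D := by rw [ell1]; exact one_le_pow₀ (by linarith)
  have ht0 : ell1 D ≤ t0 D := by
    rw [ell1, t0]; exact pow_le_pow_right₀ (by linarith) (by norm_num)
  have hc₁1 : min c₀ 1 ≤ 1 := min_le_right _ _
  have hLmLp : Lm < Lp := by linarith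
  have hLmpos : min c₀ 1 * alpha D < 2 * π * t0 D + Lm := by
    have h1 : min c₀ 1 * alpha D ≤ 1 * (1 / 100) :=
      mul_le_mul hc₁1 hα100 hα0.le zero_le_one
    nlinarith [Real.pi_gt_three]
  -- (i) the residue identity, numerator `N = L(s+β₁)·G·ω`
  set N : ℂ → ℂ := fun s => x.ψ.LFunction (s + beta1 c' D) * G s * omegaW D s with hN
  have hLd : Differentiable ℂ x.ψ.LFunction := DirichletCharacter.differentiable_LFunction x.ψ_ne_one
  have hNd : DifferentiableOn ℂ N {s : ℂ | 0 < s.im} := by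
    have h1 : Differentiable ℂ (fun s => x.ψ.LFunction (s + beta1 c' D)) :=
      hLd.comp (differentiable_id.add_const _)
    exact (h1.differentiableOn.mul hG).mul (differentiable_omegaW D).differentiableOn
  have hres := sum_div_deriv_LFunction_eq_rectIntegral χ hD3 hp x N hNd hc₁ hα0 hLmpos hLmLp
    (h22ii D χ hD2 hq hp x hx) hR
  have hsum : (∑ ρ ∈ finsetOf (zeroSet D x),
        x.ψ.LFunction (ρ + beta1 c' D) / deriv x.ψ.LFunction ρ * G ρ * omegaW D ρ) =
      ∑ ρ ∈ finsetOf (zeroSet D x), N ρ / deriv x.ψ.LFunction ρ := by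
    refine Finset.sum_congr rfl fun ρ _ => ?_
    simp only [hN]; ring
  have hint : (fun s => x.ψ.LFunction (s + beta1 c' D) / x.ψ.LFunction s * G s * omegaW D s) =
      fun s => N s / x.ψ.LFunction s := by
    funext s; simp only [hN]; ring
  -- (ii) the contour remainder
  have h22x : ∀ s ∈ prodZeroSetOmega χ x, s.re = 1 / 2 := h22i D χ hD22 hq hp x hx
  have h59x : ∀ s : ℂ, |s.re - 1 / 2| ≤ alpha D → |s.im - 2 * π * t0 D| ≤ ell1 D + 1 / 4 →
      (∀ ρ : ℂ, x.ψ.LFunction ρ = 0 → min c₀ 1 * alpha D ≤ ‖s - ρ‖) →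
        ‖x.ψ.LFunction (s + beta1 c' D) / x.ψ.LFunction s‖ ≤ C₅₉ * Real.log (bigP D) :=
    fun s h1 h2 h3 => h59 D χ hD59 hq hp x hx s h1 h2 h3
  have hedge := norm_rectIntegral_sub_segInt_le_of_bound x hc₁ le_rfl hc₁1 h80 hCL h22x
    (beta1 c' D) h59x hR G hG hGb
  -- (iii) assemble
  rw [hsum, hres, ← hint]
  refine hedge.trans ?_
  have hlogP : Real.log (bigP D) = ell D ^ 9 := by rw [bigP, Real.log_exp]
  rw [hlogP]
  have henv := envelope_of_ell (κ := κ) h80 hκL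
  have hX0 : 0 ≤ ell D ^ 9 * Real.exp (κ * ell D ^ 9) * Real.exp (2 - ell D ^ 10 / 4) := by
    positivity
  have hC : C₅₉ ≤ |C₅₉| + 1 := by linarith [le_abs_self C₅₉]
  calc C₅₉ * ell D ^ 9 * Real.exp (κ * ell D ^ 9) * Real.exp (2 - ell D ^ 10 / 4)
      = C₅₉ * (ell D ^ 9 * Real.exp (κ * ell D ^ 9) * Real.exp (2 - ell D ^ 10 / 4)) := by ring
    _ ≤ (|C₅₉| + 1) * (ell D ^ 9 * Real.exp (κ * ell D ^ 9) * Real.exp (2 - ell D ^ 10 / 4)) :=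
        mul_le_mul_of_nonneg_right hC hX0
    _ ≤ (|C₅₉| + 1) * (Real.exp 2 * Real.exp (-(ell D ^ 10 / 8))) :=
        mul_le_mul_of_nonneg_left henv (by positivity)
    _ = (|C₅₉| + 1) * Real.exp 2 * Real.exp (-(ell D ^ 10 / 8)) := by ring

end Literature.NumberTheory.LFunctions.Zhang2022.Section8aStatements
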